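import Mathlib

/-!
# The reflexive hull of a finite extension of domains — sub-goal (H1a) of stub (R)
# `stub_raynaudConnectedness`

Route `SkinnerWilesDefectOne`, crux `ReducibleOrdinaryProModular` (stmt-Langlands-12919), line
`fine-selmer-codimension-two`, registered stub (R) `stub_raynaudConnectedness` (Grothendieck's
connectedness theorem SGA2 XIII 2.1 in crossing form).  In the HLVT-free proof of (R) the
normalisation of a complete local domain `D` is replaced by the **reflexive hull** of `D` over a
Noetherian (Cohen) subring `S ⊆ D` over which `D` is finite; this file is that hull's construction —
pure module theory over a domain, sorry-free, Mathlib only: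

* `Theorems.exists_linearMap_eq_mul_of_forall_dvd` — exact division of an `S`-valued functional by
  a non-zero scalar;
* `Theorems.exists_injective_linearMap_pi_of_isTorsionFree` — a finite torsion-free module over a
  domain embeds in a finite free module (the PID-free half of Mathlib's
  `Module.basisOfFiniteTypeTorsionFree`);
* `Theorems.exists_subalgebra_mem_iff_forall_dual_dvd` — the hull
  `D⁺⁺ := {d/s ∈ Frac D : s ∣ φ(d) for all φ ∈ Hom_S(D, S)}` is a `D`-subalgebra of `Frac D`;
* `Theorems.exists_dual_extension_of_forall_dual_dvd` — every `φ ∈ Hom_S(D, S)` extends to an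
  `S`-linear functional of `D⁺⁺`;
* `Theorems.exists_reflexiveHull_injective_range_eq_ker` — for `S` Noetherian and `D` finite
  torsion-free over `S`, `D⁺⁺` sits in an exact sequence of `S`-modules `0 → D⁺⁺ → Sᵃ → Sᵇ`
  (so it is a finite `S`-module and a second syzygy);
* `FineSelmerCodimensionTwo.stub_raynaudConnectedness_auxHull` — the REGISTERED sub-goal (H1a),
  binders verbatim, at universe `0`.

References: A. Grothendieck, SGA 2, Exp. XIII Thm. 2.1 [Grothendieck1968SGA2]; N. Bourbaki,
*Algèbre commutative* VII §4.2 (reflexive modules, `M⁺⁺ = {x ∈ M ⊗ K : φ(x) ∈ A ∀ φ ∈ M⁺}`)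
[BourbakiAC]; H. Matsumura, *Commutative Ring Theory*, §29 (Cohen structure theory) [Matsumura1987].
-/

set_option linter.dupNamespace false -- project-wide option (lakefile weak.linter.dupNamespace); `Summit.Langlands.Langlands` is the mandated namespace
set_option autoImplicit false

namespace Summit.Langlands.Langlands.Theorems

open Module

/-! ## 1. Two lemmas on modules over a domain -/

/-- **Exact division of a linear functional by a non-zero scalar.**  Over a domain, a functional all
of whose values are divisible by `s ≠ 0` is `s` times a (unique) functional. [folklore] -/
theorem exists_linearMap_eq_mul_of_forall_dvd {R M : Type*} [CommRing R] [IsDomain R]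
    [AddCommGroup M] [Module R M] (ψ : M →ₗ[R] R) {s : R} (hs : s ≠ 0) (h : ∀ m, s ∣ ψ m) :
    ∃ χ : M →ₗ[R] R, ∀ m, ψ m = s * χ m := by
  choose c hc using h
  refine ⟨{ toFun := c, map_add' := fun m m' => ?_, map_smul' := fun r m => ?_ }, hc⟩
  · apply mul_left_cancel₀ hs
    rw [← hc, map_add, hc, hc, mul_add]
  · apply mul_left_cancel₀ hs
    rw [← hc, map_smul, hc, smul_eq_mul, RingHom.id_apply, smul_eq_mul, mul_left_comm]

/-- **A finite torsion-free module over a domain embeds in a finite free module.**  If `A ≠ 0` kills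
`M` modulo the span `N` of a maximal linearly independent subfamily of a finite generating family,
then `m ↦ A • m` embeds `M` into the free module `N`. [folklore] -/
theorem exists_injective_linearMap_pi_of_isTorsionFree (R M : Type*) [CommRing R] [IsDomain R]
    [AddCommGroup M] [Module R M] [Module.Finite R M] [IsTorsionFree R M] :
    ∃ (n : ℕ) (f : M →ₗ[R] (Fin n → R)), Function.Injective f := by
  classical
  -- adapted from Mathlib `Module.basisOfFiniteTypeTorsionFree` (the PID-free first half)
  obtain ⟨k, s, hs⟩ := Module.Finite.exists_fin (R := R) (M := M)
  obtain ⟨I, indepI, hI⟩ := exists_maximal_linearIndepOn R s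
  let N : Submodule R M := Submodule.span R (Set.range fun x : I => s x)
  let bN : Basis I R N := Basis.span indepI
  have exists_a : ∀ i : Fin k, ∃ a : R, a ≠ 0 ∧ a • s i ∈ N := by
    intro i
    by_cases hi : i ∈ I
    · refine ⟨1, one_ne_zero, ?_⟩
      rw [one_smul]
      exact Submodule.subset_span (Set.mem_range_self (⟨i, hi⟩ : I))
    · simpa [N, Set.image_eq_range s I] using hI i hi
  choose a ha ha' using exists_a
  have hA : (∏ i, a i) ≠ 0 := Finset.prod_ne_zero_iff.mpr fun i _ => ha i
  let φ : M →ₗ[R] M := LinearMap.lsmul R M (∏ i, a i)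
  have hφ : Function.Injective φ := LinearMap.ker_eq_bot.mp (LinearMap.ker_lsmul hA)
  have hφN : ∀ m, φ m ∈ N := by
    suffices h : LinearMap.range φ ≤ N from fun m => h (LinearMap.mem_range_self φ m)
    rw [LinearMap.range_eq_map, ← hs, Submodule.map_span_le]
    rintro _ ⟨i, rfl⟩
    have : φ (s i) = (∏ j ∈ {i}ᶜ, a j) • a i • s i := by
      rw [LinearMap.lsmul_apply, Fintype.prod_eq_prod_compl_mul i, mul_smul]
    rw [this]
    exact N.smul_mem _ (ha' i)
  let e := (bN.reindex (Fintype.equivFin I)).equivFun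
  refine ⟨Fintype.card I, e.toLinearMap ∘ₗ φ.codRestrict N hφN, fun x y hxy => ?_⟩
  change e (φ.codRestrict N hφN x) = e (φ.codRestrict N hφN y) at hxy
  exact hφ (Subtype.ext_iff.mp (e.injective hxy))

/-! ## 2. The reflexive hull of a domain finite over a subring, inside its fraction field -/

section Hull

variable {S D : Type*} [CommRing S] [CommRing D] [Algebra S D]

/-- Two fractions `d / s = d' / s'` (`d, d' ∈ D`, `s, s' ∈ S`) in `Frac D` cross-multiply in `D`. [folklore] -/
theorem smul_eq_smul_of_algebraMap_mul_eq {x : FractionRing D} {d d' : D} {s s' : S}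
    (h : algebraMap S (FractionRing D) s * x = algebraMap D (FractionRing D) d)
    (h' : algebraMap S (FractionRing D) s' * x = algebraMap D (FractionRing D) d') :
    s' • d = s • d' := by
  apply IsFractionRing.injective D (FractionRing D)
  rw [Algebra.smul_def, Algebra.smul_def, map_mul, map_mul,
    ← IsScalarTower.algebraMap_apply, ← IsScalarTower.algebraMap_apply, ← h, ← h']
  ring

variable [IsDomain S]

variable (S D) in
/-- **The reflexive hull `D⁺⁺ ⊆ Frac D` of a ring `D` over a sub-domain `S` is a `D`-subalgebra.**
Here `D⁺⁺ := {x = d/s ∈ Frac D (d ∈ D, 0 ≠ s ∈ S) : s ∣ φ(d) for every S-linear φ : D → S}`, i.e.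
the fractions with denominator in `S` on which every `S`-linear functional of `D` takes values in
`S`; it contains `D` and is closed under sums and products (for `y = d'/s' ∈ D⁺⁺` the functional
`e ↦ φ(e d')/s'` is again `S`-linear, so `x = d/s ∈ D⁺⁺` gives `s s' ∣ φ(d d')`).  No finiteness,
Noetherianity or normality is needed. [folklore] -/
theorem exists_subalgebra_mem_iff_forall_dual_dvd :
    ∃ D' : Subalgebra D (FractionRing D), ∀ x : FractionRing D, x ∈ D' ↔
      ∃ (d : D) (s : S), s ≠ 0 ∧ algebraMap S (FractionRing D) s * x = algebraMap D (FractionRing D) d ∧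
        ∀ φ : D →ₗ[S] S, s ∣ φ d := by
  refine ⟨{ carrier := {x | ∃ (d : D) (s : S), s ≠ 0 ∧
      algebraMap S (FractionRing D) s * x = algebraMap D (FractionRing D) d ∧ ∀ φ : D →ₗ[S] S, s ∣ φ d}
            mul_mem' := ?_, one_mem' := ?_, add_mem' := ?_, zero_mem' := ?_, algebraMap_mem' := ?_ },
          fun x => Iff.rfl⟩
  · -- products
    rintro x y ⟨d, s, hs, hx, hdx⟩ ⟨d', s', hs', hy, hdy⟩
    refine ⟨d * d', s * s', mul_ne_zero hs hs', ?_, fun φ => ?_⟩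
    · rw [map_mul, map_mul, ← hx, ← hy]; ring
    · -- `e ↦ φ (e * d')` is divisible by `s'`, hence `= s' * χ`; then `s ∣ χ d`
      obtain ⟨χ, hχ⟩ := exists_linearMap_eq_mul_of_forall_dvd (φ ∘ₗ LinearMap.mulRight S d') hs'
        fun e => by simpa using hdy (φ ∘ₗ LinearMap.mulLeft S e)
      obtain ⟨c, hc⟩ := hdx χ
      refine ⟨c, ?_⟩
      have := hχ d
      simp only [LinearMap.comp_apply, LinearMap.mulRight_apply] at this
      rw [this, hc]; ring
  · exact ⟨1, 1, one_ne_zero, by simp, fun φ => one_dvd _⟩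
  · -- sums
    rintro x y ⟨d, s, hs, hx, hdx⟩ ⟨d', s', hs', hy, hdy⟩
    refine ⟨s' • d + s • d', s * s', mul_ne_zero hs hs', ?_, fun φ => ?_⟩
    · rw [map_add, Algebra.smul_def, Algebra.smul_def, map_mul, map_mul, map_mul,
        ← IsScalarTower.algebraMap_apply, ← IsScalarTower.algebraMap_apply, ← hx, ← hy]
      ring
    · obtain ⟨c, hc⟩ := hdx φ
      obtain ⟨c', hc'⟩ := hdy φ
      rw [map_add, map_smul, map_smul, smul_eq_mul, smul_eq_mul, hc, hc']
      exact ⟨c + c', by ring⟩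
  · exact ⟨0, 1, one_ne_zero, by simp, fun φ => by simp⟩
  · intro r
    exact ⟨r, 1, one_ne_zero, by simp, fun φ => one_dvd _⟩

/-- **`S`-linear functionals of `D` extend to the reflexive hull.**  If every element of a
`D`-subalgebra `D' ⊆ Frac D` is a fraction `d/s` with `s ∣ φ(d)` for all `φ ∈ Hom_S(D, S)`, then every
such `φ` extends to an `S`-linear `Φ : D' → S` with `s · Φ(x) = φ(d)` whenever `s x = d`
(well defined by cross-multiplication, `S` being a domain). [folklore] -/
theorem exists_dual_extension_of_forall_dual_dvd (D' : Subalgebra D (FractionRing D))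
    (hD' : ∀ x ∈ D', ∃ (d : D) (s : S), s ≠ 0 ∧
      algebraMap S (FractionRing D) s * x = algebraMap D (FractionRing D) d ∧ ∀ φ : D →ₗ[S] S, s ∣ φ d)
    (φ : D →ₗ[S] S) :
    ∃ Φ : D' →ₗ[S] S, ∀ (x : D') (d : D) (s : S),
      algebraMap S (FractionRing D) s * (x : FractionRing D) = algebraMap D (FractionRing D) d →
        s * Φ x = φ d := by
  choose rd rs hrs hrep hdvd using hD'
  choose c hc using fun x : D' => hdvd x.1 x.2 φ
  -- the value `c x` does not depend on the representation
  have key : ∀ (x : D') (d : D) (s : S),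
      algebraMap S (FractionRing D) s * (x : FractionRing D) = algebraMap D (FractionRing D) d →
        s * c x = φ d := by
    intro x d s h
    apply mul_left_cancel₀ (hrs x.1 x.2)
    have e := congrArg φ (smul_eq_smul_of_algebraMap_mul_eq (hrep x.1 x.2) h)
    rw [map_smul, map_smul, smul_eq_mul, smul_eq_mul, hc] at e
    rw [← e]; ring
  refine ⟨{ toFun := c, map_add' := fun x y => ?_, map_smul' := fun r x => ?_ }, key⟩
  · -- a representation of `x + y`
    have hx := hrep x.1 x.2
    have hy := hrep y.1 y.2
    have hxy : algebraMap S (FractionRing D) (rs x.1 x.2 * rs y.1 y.2) * ((x + y : D') : FractionRing D) =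
        algebraMap D (FractionRing D) (rs y.1 y.2 • rd x.1 x.2 + rs x.1 x.2 • rd y.1 y.2) := by
      rw [Subalgebra.coe_add, map_add, Algebra.smul_def, Algebra.smul_def, map_mul, map_mul, map_mul,
        ← IsScalarTower.algebraMap_apply, ← IsScalarTower.algebraMap_apply, ← hx, ← hy]
      ring
    have e := key (x + y) _ _ hxy
    rw [map_add, map_smul, map_smul, smul_eq_mul, smul_eq_mul, ← key x _ _ hx, ← key y _ _ hy] at e
    apply mul_left_cancel₀ (mul_ne_zero (hrs x.1 x.2) (hrs y.1 y.2))
    rw [e]; ring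
  · have hx := hrep x.1 x.2
    have hrx : algebraMap S (FractionRing D) (rs x.1 x.2) * ((r • x : D') : FractionRing D) =
        algebraMap D (FractionRing D) (r • rd x.1 x.2) := by
      rw [Subalgebra.coe_smul, Algebra.smul_def, Algebra.smul_def, map_mul,
        ← IsScalarTower.algebraMap_apply, ← hx]
      ring
    have e := key (r • x) _ _ hrx
    rw [map_smul, smul_eq_mul, ← key x _ _ hx] at e
    apply mul_left_cancel₀ (hrs x.1 x.2)
    rw [RingHom.id_apply, smul_eq_mul, e]; ring

end Hull

/-! ## 3. The hull is a second syzygy: `0 → D⁺⁺ → Sᵃ → Sᵇ` exact -/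

/-- **The reflexive hull of a finite torsion-free extension `S ⊆ D` of domains (`S` Noetherian) sits in
an exact sequence `0 → D⁺⁺ → Sᵃ → Sᵇ` of `S`-modules.**  With `φ₁, …, φₐ` generating the finite
`S`-module `Hom_S(D, S)`, `Φ := (φ̂ⱼ)ⱼ : D⁺⁺ → Sᵃ` (the extensions of the `φⱼ`) is injective because
`Hom_S(D, S)` separates the points of the torsion-free module `D ↪ Sⁿ`; its image `N` is *saturated*
(`t v ∈ N, t ≠ 0 ⇒ v ∈ N`: if `t v = Φ(x)` then every functional is `S`-valued on `x / t`, so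
`x / t ∈ D⁺⁺` — the hull property), hence `Sᵃ/N` is finite torsion-free, embeds in some `Sᵇ`, and
`N = ker (Sᵃ → Sᵃ/N ↪ Sᵇ)`. [folklore] -/
theorem exists_reflexiveHull_injective_range_eq_ker (S D : Type*) [CommRing S] [IsDomain S]
    [IsNoetherianRing S] [CommRing D] [IsDomain D] [Algebra S D] [Module.Finite S D]
    (hinj : Function.Injective (algebraMap S D)) :
    ∃ (D' : Subalgebra D (FractionRing D)) (a b : ℕ) (Φ : D' →ₗ[S] (Fin a → S))
      (Ψ : (Fin a → S) →ₗ[S] (Fin b → S)), Function.Injective Φ ∧ LinearMap.range Φ = LinearMap.ker Ψ := by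
  haveI : IsTorsionFree S D := Module.isTorsionFree_iff_algebraMap_injective.mpr hinj
  obtain ⟨D', hD'⟩ := exists_subalgebra_mem_iff_forall_dual_dvd S D
  -- generators `φs j` of the finite `S`-module `Hom_S(D, S)` and their extensions `ext j` to `D'`
  obtain ⟨a, φs, hφs⟩ := Module.Finite.exists_fin (R := S) (M := D →ₗ[S] S)
  have hgen : ∀ φ : D →ₗ[S] S, ∃ c : Fin a → S, ∑ j, c j • φs j = φ := fun φ =>
    (Submodule.mem_span_range_iff_exists_fun S).mp (hφs ▸ Submodule.mem_top)
  choose ext hext using fun j => exists_dual_extension_of_forall_dual_dvd D' (fun x hx => (hD' x).mp hx) (φs j)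
  let Φ : D' →ₗ[S] (Fin a → S) := LinearMap.pi ext
  have hΦ : ∀ (x : D') (j : Fin a), Φ x j = ext j x := fun x j => rfl
  have hSL : Function.Injective (algebraMap S (FractionRing D)) := by
    rw [IsScalarTower.algebraMap_eq S D (FractionRing D), RingHom.coe_comp]
    exact (IsFractionRing.injective D (FractionRing D)).comp hinj
  have hS : ∀ {s : S}, s ≠ 0 → algebraMap S (FractionRing D) s ≠ 0 := fun hs =>
    (map_ne_zero_iff _ hSL).mpr hs
  -- `Φ` is injective
  have hΦinj : Function.Injective Φ := by
    rw [← LinearMap.ker_eq_bot, LinearMap.ker_eq_bot']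
    intro x hx
    obtain ⟨d, s, hs, hsx, -⟩ := (hD' x).mp x.2
    have h1 : ∀ j, φs j d = 0 := fun j => by
      rw [← hext j x d s hsx, ← hΦ, hx, Pi.zero_apply, mul_zero]
    have h2 : ∀ φ : D →ₗ[S] S, φ d = 0 := fun φ => by
      obtain ⟨c, rfl⟩ := hgen φ
      simp [h1]
    obtain ⟨n, f, hf⟩ := exists_injective_linearMap_pi_of_isTorsionFree S D
    have hd : d = 0 := hf (by
      rw [map_zero]
      exact funext fun i => h2 ((LinearMap.proj i).comp f))
    rw [hd, map_zero, mul_eq_zero] at hsx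
    exact Subtype.ext (hsx.resolve_left (hS hs))
  -- the image of `Φ` is saturated
  have hsat : ∀ (v : Fin a → S) (t : S), t ≠ 0 → t • v ∈ LinearMap.range Φ →
      v ∈ LinearMap.range Φ := by
    rintro v t ht ⟨x₀, hx₀⟩
    obtain ⟨d, s, hs, hsx, -⟩ := (hD' x₀).mp x₀.2
    have hval : ∀ j, φs j d = s * (t * v j) := fun j => by
      rw [← hext j x₀ d s hsx, ← hΦ, hx₀]; rfl
    -- `y := x₀ / t` lies in the hull and `Φ y = v`
    set y : FractionRing D := (algebraMap S (FractionRing D) t)⁻¹ * (x₀ : FractionRing D) with hy_def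
    have hy : algebraMap S (FractionRing D) (s * t) * y = algebraMap D (FractionRing D) d := by
      rw [← hsx, hy_def, map_mul, mul_assoc, mul_inv_cancel_left₀ (hS ht)]
    have hymem : y ∈ D' := (hD' y).mpr ⟨d, s * t, mul_ne_zero hs ht, hy, fun φ => by
      obtain ⟨c, rfl⟩ := hgen φ
      rw [LinearMap.sum_apply]
      exact Finset.dvd_sum fun j _ => ⟨c j * v j, by
        rw [LinearMap.smul_apply, hval j, smul_eq_mul]; ring⟩⟩
    refine ⟨⟨y, hymem⟩, funext fun j => ?_⟩
    have e := hext j ⟨y, hymem⟩ d (s * t) hy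
    rw [hval j, ← mul_assoc] at e
    rw [hΦ]
    exact mul_left_cancel₀ (mul_ne_zero hs ht) e
  -- `Sᵃ / N` is finite torsion-free, hence embeds in some `Sᵇ`
  haveI : IsTorsionFree S ((Fin a → S) ⧸ LinearMap.range Φ) :=
    IsTorsionFree.of_smul_eq_zero fun r m hrm => by
      induction m using Submodule.Quotient.induction_on with
      | H v =>
        by_cases hr : r = 0
        · exact Or.inl hr
        · refine Or.inr ((Submodule.Quotient.mk_eq_zero _).mpr (hsat v r hr ?_))
          rwa [← Submodule.Quotient.mk_smul, Submodule.Quotient.mk_eq_zero] at hrm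
  obtain ⟨b, g, hg⟩ := exists_injective_linearMap_pi_of_isTorsionFree S ((Fin a → S) ⧸ LinearMap.range Φ)
  refine ⟨D', a, b, Φ, g ∘ₗ (LinearMap.range Φ).mkQ, hΦinj, ?_⟩
  rw [LinearMap.ker_comp, LinearMap.ker_eq_bot.mpr hg, Submodule.comap_bot, Submodule.ker_mkQ]

end Summit.Langlands.Langlands.Theorems

/-! ## 4. The registered sub-goal (verbatim signature) -/

namespace Summit.Langlands.Langlands.Cruxes.ReducibleOrdinaryProModular.FineSelmerCodimensionTwo

/-- **Registered sub-goal `stub_raynaudConnectedness_auxHull` of stub (R) `stub_raynaudConnectedness`**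
(part (H1a) of the SGA2 XIII 2.1 programme): for a domain `D` finite and torsion-free over a
Noetherian domain `S` there is a `D`-subalgebra `D'` of `Frac D` (the reflexive hull of `D` over `S`)
with an exact sequence of `S`-modules `0 → D' → Sᵃ → Sᵇ` —
`Theorems.exists_reflexiveHull_injective_range_eq_ker` at universe `0`. [folklore] -/
theorem stub_raynaudConnectedness_auxHull :
    ∀ (S : Type) [CommRing S] [IsDomain S] [IsNoetherianRing S] (D : Type) [CommRing D] [IsDomain D]
      [Algebra S D] [Module.Finite S D], Function.Injective (algebraMap S D) →
      ∃ (D' : Subalgebra D (FractionRing D)) (a b : ℕ) (Φ : D' →ₗ[S] (Fin a → S))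
        (Ψ : (Fin a → S) →ₗ[S] (Fin b → S)), Function.Injective Φ ∧ LinearMap.range Φ = LinearMap.ker Ψ :=
  fun S _ _ _ D _ _ _ _ hinj =>
    Summit.Langlands.Langlands.Theorems.exists_reflexiveHull_injective_range_eq_ker S D hinj

end Summit.Langlands.Langlands.Cruxes.ReducibleOrdinaryProModular.FineSelmerCodimensionTwo
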